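import Mathlib.Analysis.Calculus.Deriv.MeanValue
import Mathlib.Analysis.Calculus.Deriv.Inv
import Mathlib.Analysis.SpecialFunctions.Log.Deriv

/-!
# `ErgoregionBombModT` — brick R23 of line `SketchIdeator4` (zero-energy escape):
# Riccati blow-up rate and logarithmic divergence on a finite end

Route `ZeroEnergyKerrOrBomb` of the Final State Conjecture, crux
`Summit.FinalStateConjecture.FinalStateConjecture.Theses.ZeroEnergyKerrOrBomb.ErgoregionBombModT`
(stmt-FinalStateConjecture-17838), line `SketchIdeator4`, registered stub
`stub_riccatiLogDivergence` (R23, species (b): a FINITE end `b` of the parameter domain of the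
confined zero-energy null geodesic).

Pure one-variable calculus.  On `[t₀, b)` we are given real functions with `φ' = u`,
`u' = w ≥ c ρ²`, `ρ' = v`, `|v| ≤ C ρ²`, `ρ > 0`, and `ρ` unbounded on `[t₀, b)`; we prove that
`φ` is unbounded above on `[t₀, b)`.  The argument:

1. RATE (`inv_le_of_riccati`): `1/ρ(t) ≤ C (b - t)` on `[t₀, b)`.  The function `1/ρ + C·id`
   has derivative `-v/ρ² + C ≥ 0`, hence is monotone; if `1/ρ(t) > C (b - t)` at some `t`,
   monotonicity bounds `ρ` on `[t, b)` and continuity bounds it on `[t₀, t]`, contradicting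
   unboundedness.
2. Hence `w ≥ c ρ² ≥ κ/(b - t)²` with `κ := c/C²`.
3. `u - κ/(b - ·)` has derivative `w - κ/(b - ·)² ≥ 0`, so `u(t) ≥ A + κ/(b - t)` with
   `A := u(t₀) - κ/(b - t₀)`.
4. `φ - A·id + κ log (b - ·)` has derivative `u - A - κ/(b - ·) ≥ 0`, so
   `φ(t) ≥ φ(t₀) + A (t - t₀) + κ (log (b - t₀) - log (b - t)) → +∞` as `t → b⁻`.

Monotonicity from the sign of the derivative is Mathlib's `monotoneOn_of_hasDerivWithinAt_nonneg`
on the convex set `Set.Ico t₀ b`.  Nothing Lorentzian is imported here; the geometric inputs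
(`ρ` unbounded at a finite end, the Hessian bounds) are supplied by the other bricks of the line.
-/

noncomputable section

open Set

-- summit = problem name (D-0017)
set_option linter.dupNamespace false

namespace Summit.FinalStateConjecture.FinalStateConjecture.Theorems.ErgoregionBombModT

/-- Monotonicity on `[t₀, b)` from a nonnegative derivative given pointwise on `[t₀, b)`
(a repackaging of `monotoneOn_of_hasDerivWithinAt_nonneg` for `HasDerivAt` data on `Set.Ico`). -/
private theorem monotoneOn_Ico_of_hasDerivAt_nonneg {f f' : ℝ → ℝ} {t₀ b : ℝ}
    (hf : ∀ t ∈ Ico t₀ b, HasDerivAt f (f' t) t) (hf' : ∀ t ∈ Ico t₀ b, 0 ≤ f' t) :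
    MonotoneOn f (Ico t₀ b) :=
  monotoneOn_of_hasDerivWithinAt_nonneg (convex_Ico t₀ b)
    (fun t ht => (hf t ht).continuousAt.continuousWithinAt)
    (fun t ht => (hf t (interior_subset ht)).hasDerivWithinAt)
    (fun t ht => hf' t (interior_subset ht))

/-- **Riccati rate.** If `ρ > 0` on `[t₀, b)` has derivative `v` with `|v| ≤ C ρ²` (`C > 0`)
and `ρ` is unbounded on `[t₀, b)`, then `1/ρ(t) ≤ C (b - t)` for every `t ∈ [t₀, b)`. -/
private theorem inv_le_of_riccati {ρ v : ℝ → ℝ} {t₀ b C : ℝ} (hC : 0 < C)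
    (hρ' : ∀ t ∈ Ico t₀ b, HasDerivAt ρ (v t) t) (hρ : ∀ t ∈ Ico t₀ b, 0 < ρ t)
    (hv : ∀ t ∈ Ico t₀ b, |v t| ≤ C * ρ t ^ 2)
    (hunb : ∀ n : ℕ, ∃ t ∈ Ico t₀ b, (n : ℝ) ≤ ρ t) :
    ∀ t ∈ Ico t₀ b, (ρ t)⁻¹ ≤ C * (b - t) := by
  intro t ht
  by_contra h
  have h : C * (b - t) < (ρ t)⁻¹ := not_le.1 h
  -- `δ` is the defect; we show `ρ ≤ max B δ⁻¹` on `[t₀, b)`, contradicting unboundedness.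
  set δ := (ρ t)⁻¹ - C * (b - t) with hδ
  have hδpos : 0 < δ := sub_pos.2 h
  -- the function `1/ρ + C·id` is monotone on `[t₀, b)`
  have hmono : MonotoneOn (fun s => (ρ s)⁻¹ + s * C) (Ico t₀ b) := by
    apply monotoneOn_Ico_of_hasDerivAt_nonneg (f' := fun s => -(v s) / ρ s ^ 2 + C)
    · intro s hs
      exact ((hρ' s hs).inv (hρ s hs).ne').fun_add (hasDerivAt_mul_const C)
    · intro s hs
      have h2 : v s ≤ C * ρ s ^ 2 := (le_abs_self _).trans (hv s hs)
      have hρ2 : 0 < ρ s ^ 2 := pow_pos (hρ s hs) 2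
      have h3 : v s / ρ s ^ 2 ≤ C := (div_le_iff₀ hρ2).2 h2
      rw [neg_div]
      linarith
  -- `ρ` is bounded on the compact interval `[t₀, t]`
  have hcont : ContinuousOn ρ (Icc t₀ t) := fun s hs =>
    (hρ' s ⟨hs.1, lt_of_le_of_lt hs.2 ht.2⟩).continuousAt.continuousWithinAt
  obtain ⟨B, hB⟩ := isCompact_Icc.exists_bound_of_continuousOn hcont
  -- hence `ρ ≤ max B δ⁻¹` on `[t₀, b)`
  have hbound : ∀ s ∈ Ico t₀ b, ρ s ≤ max B δ⁻¹ := by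
    intro s hs
    rcases le_total s t with hst | hts
    · exact ((Real.le_norm_self _).trans (hB s ⟨hs.1, hst⟩)).trans (le_max_left _ _)
    · have hm := hmono ht hs hts
      simp only at hm
      have h1 : δ < (ρ s)⁻¹ := by
        have hsb : s * C < b * C := mul_lt_mul_of_pos_right hs.2 hC
        rw [hδ]; linarith
      exact (((lt_inv_comm₀ hδpos (hρ s hs)).1 h1).le).trans (le_max_right _ _)
  -- contradiction with unboundedness
  obtain ⟨n, hn⟩ := exists_nat_gt (max B δ⁻¹)
  obtain ⟨s, hs, hns⟩ := hunb n
  exact absurd ((hns.trans (hbound s hs)).trans_lt hn) (lt_irrefl _)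

/-- **R23 (real line, species (b)): Riccati blow-up rate and logarithmic divergence.**
On `[t₀, b)`: if `φ' = u`, `u' = w ≥ c ρ²`, `ρ' = v`, `|v| ≤ C ρ²`, `ρ > 0`, and `ρ` is unbounded
on `[t₀, b)`, then `φ` is unbounded above on `[t₀, b)` (`1/ρ(t) ≤ C (b - t)`, hence
`u' ≥ c/(C²(b−t)²)`, hence `φ ≥ const + (c/C²) log(1/(b−t))`).  Elementary real analysis
(mean value theorem in the form "nonnegative derivative ⇒ monotone").  Registered stub
`stub_riccatiLogDivergence` (R23) of crux stmt-FinalStateConjecture-17838, line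
`SketchIdeator4`. -/
theorem stub_riccatiLogDivergence :
    ∀ (φ u w ρ v : ℝ → ℝ) (t₀ b c C : ℝ), t₀ < b → 0 < c → 0 < C →
      (∀ t ∈ Set.Ico t₀ b, HasDerivAt φ (u t) t) →
      (∀ t ∈ Set.Ico t₀ b, HasDerivAt u (w t) t) →
      (∀ t ∈ Set.Ico t₀ b, HasDerivAt ρ (v t) t) → (∀ t ∈ Set.Ico t₀ b, 0 < ρ t) →
      (∀ t ∈ Set.Ico t₀ b, c * ρ t ^ 2 ≤ w t) →
      (∀ t ∈ Set.Ico t₀ b, |v t| ≤ C * ρ t ^ 2) →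
      (∀ n : ℕ, ∃ t ∈ Set.Ico t₀ b, (n : ℝ) ≤ ρ t) →
      ∀ M : ℝ, ∃ t ∈ Set.Ico t₀ b, M < φ t := by
  intro φ u w ρ v t₀ b c C hb hc hC hφ' hu' hρ' hρ hw hv hunb M
  have ht₀ : t₀ ∈ Ico t₀ b := left_mem_Ico.2 hb
  -- Step 1: the Riccati rate
  have hrate := inv_le_of_riccati hC hρ' hρ hv hunb
  -- Step 2: `w ≥ κ / (b - t)²`
  set κ := c / C ^ 2 with hκ
  have hκpos : 0 < κ := by positivity
  have hwlow : ∀ t ∈ Ico t₀ b, κ / (b - t) ^ 2 ≤ w t := by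
    intro t ht
    have hbt : 0 < b - t := sub_pos.2 ht.2
    have hρt := hρ t ht
    have h1 : 1 ≤ ρ t * (C * (b - t)) := by
      have := mul_le_mul_of_nonneg_left (hrate t ht) hρt.le
      rwa [mul_inv_cancel₀ hρt.ne'] at this
    have h2 : 1 ≤ (ρ t * (C * (b - t))) ^ 2 := one_le_pow₀ h1
    refine le_trans ?_ (hw t ht)
    rw [div_le_iff₀ (pow_pos hbt 2), hκ, div_le_iff₀ (pow_pos hC 2)]
    calc c = c * 1 := (mul_one c).symm
      _ ≤ c * (ρ t * (C * (b - t))) ^ 2 := mul_le_mul_of_nonneg_left h2 hc.le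
      _ = c * ρ t ^ 2 * (b - t) ^ 2 * C ^ 2 := by ring
  -- Step 3: `u t ≥ A + κ / (b - t)`
  set A := u t₀ - κ / (b - t₀) with hA
  have hulow : ∀ t ∈ Ico t₀ b, A + κ / (b - t) ≤ u t := by
    have hmono : MonotoneOn (fun t => u t - κ * (b - t)⁻¹) (Ico t₀ b) := by
      apply monotoneOn_Ico_of_hasDerivAt_nonneg (f' := fun t => w t - κ / (b - t) ^ 2)
      · intro t ht
        have hbt : b - t ≠ 0 := (sub_pos.2 ht.2).ne'
        have h1 : HasDerivAt (fun s => (b - s)⁻¹) (-(-1) / (b - t) ^ 2) t :=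
          ((hasDerivAt_id' t).const_sub b).inv hbt
        refine ((hu' t ht).fun_sub (h1.const_mul κ)).congr_deriv ?_
        ring
      · intro t ht
        have := hwlow t ht
        linarith
    intro t ht
    have hm := hmono ht₀ ht ht.1
    simp only at hm
    rw [hA, div_eq_mul_inv, div_eq_mul_inv]
    linarith
  -- Step 4: `φ t ≥ φ t₀ + A (t - t₀) + κ (log (b - t₀) - log (b - t))`
  have hφlow : ∀ t ∈ Ico t₀ b,
      φ t₀ - A * t₀ + κ * Real.log (b - t₀) ≤ φ t - A * t + κ * Real.log (b - t) := by
    have hmono : MonotoneOn (fun t => φ t - A * t + κ * Real.log (b - t)) (Ico t₀ b) := by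
      apply monotoneOn_Ico_of_hasDerivAt_nonneg (f' := fun t => u t - A - κ / (b - t))
      · intro t ht
        have hbt : b - t ≠ 0 := (sub_pos.2 ht.2).ne'
        have h1 : HasDerivAt (fun s => Real.log (b - s)) ((-1) / (b - t)) t :=
          ((hasDerivAt_id' t).const_sub b).log hbt
        refine (((hφ' t ht).fun_sub (hasDerivAt_const_mul A)).fun_add
          (h1.const_mul κ)).congr_deriv ?_
        ring
      · intro t ht
        have := hulow t ht
        linarith
    intro t ht
    exact hmono ht₀ ht ht.1
  -- Conclusion: choose `t = b - δ` with `δ` small.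
  set K₀ := φ t₀ - |A| * (b - t₀) + κ * Real.log (b - t₀) with hK₀
  set L := (K₀ - M) / κ - 1 with hL
  set δ := min ((b - t₀) / 2) (Real.exp L) with hδ
  have hδpos : 0 < δ := lt_min (by linarith) (Real.exp_pos L)
  have hδle : δ ≤ (b - t₀) / 2 := min_le_left _ _
  have ht : b - δ ∈ Ico t₀ b := ⟨by linarith, by linarith⟩
  refine ⟨b - δ, ht, ?_⟩
  have h1 := hφlow (b - δ) ht
  have hbδ : b - (b - δ) = δ := by ring
  rw [hbδ] at h1
  -- `log δ ≤ L`
  have hlog : Real.log δ ≤ L := by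
    have := Real.log_le_log hδpos (min_le_right _ _)
    rwa [Real.log_exp] at this
  have hκlog : κ * Real.log δ ≤ K₀ - M - κ := by
    have := mul_le_mul_of_nonneg_left hlog hκpos.le
    have hLκ : κ * L = K₀ - M - κ := by
      rw [hL]; field_simp
    linarith
  -- `A (t - t₀) ≥ -|A| (b - t₀)`
  have hAt : -|A| * (b - t₀) ≤ A * (b - δ - t₀) := by
    have h3 : -|A| * (b - δ - t₀) ≤ A * (b - δ - t₀) :=
      mul_le_mul_of_nonneg_right (neg_abs_le A) (by linarith [ht.1])
    have h4 : -|A| * (b - t₀) ≤ -|A| * (b - δ - t₀) :=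
      mul_le_mul_of_nonpos_left (by linarith) (neg_nonpos.2 (abs_nonneg A))
    exact h4.trans h3
  rw [hK₀] at hκlog
  nlinarith [h1, hκlog, hAt]

end Summit.FinalStateConjecture.FinalStateConjecture.Theorems.ErgoregionBombModT
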